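import Literature.Analysis.FluidPDE.LoadedCollisionRecord
import Literature.Analysis.FluidPDE.HardSphereFlowJointMeasurable
import HarnessLib

/-!
# Contact records of a loaded-sphere flow: measurability in the initial datum

Companion to `Literature.Analysis.FluidPDE.LoadedCollisionRecord`, which defines, along a
loaded-sphere flow `Ψ : LoadedSphereFlow G ε ξ ι N` (`LoadedSphereDynamics`), the `n`-th contact
time of a particle `Ψ.nthCollisionTimeOf i n`, its partner, the two flight starts, the contact
phases, normal, incoming / outgoing data, the coarse past `Ψ.coarsePastOf q qv i n` with its
σ-algebras `Ψ.coarsePastSigma`, `Ψ.coarsePastOthersSigma`, and the exceptional contact classes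
`IsRecontact`, `IsShortFlight`, `IsGrazing`, `IsPolar`, `HasNthContact`. Route statements condition
on these σ-algebras (`MeasureTheory.condExp` needs `Ψ.coarsePastSigma … ≤ ‹ambient›`) and integrate
indicators of these classes; this file proves that ALL these maps are measurable functions of the
initial datum and all these classes are measurable events, for a hard-sphere-regular geometry with
measurable separation map on a metrisable second-countable Borel position space (`ℝ³`, `𝕋³`):

* `LoadedSphereFlow.measurable_flow_prod` — the loaded flow is JOINTLY measurable on
  `Ψ.good × ℝ` (orbits of good data are right-continuous, `IsLoadedSphereTrajectory.tendsto_nhdsGT`;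
  dyadic approximation from the right, as `HardSphereFlow.measurable_flow_prod`);
  `measurable_flow_at` — `z ↦ Ψ_{σ(z)} z` is measurable for a measurable time `σ` vanishing off the
  good set.
* HITTING TIMES (pure measure theory, any measurable space `α`): for `f : α → ℝ → ℝ` continuous in
  `t` and measurable in `a`, the events `{a | ∃ t ∈ [p, q], f a t = 0}` are measurable
  (`measurableSet_exists_Icc_eq_zero`: compactness and a countable dense sample), hence so are the
  next zero after a measurable time, `a ↦ nextTimeAfter {t | f a t = 0} (σ a)`
  (`measurable_nextTimeAfter_setOf_eq_zero`), and the last zero before it,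
  `a ↦ sSup (insert a₀ ({t | f a t = 0} ∩ Ioo a₀ (σ a)))` (`measurable_sSup_insert_setOf_eq_zero`).
* the PARTICIPATION GAUGE `contactGauge G ε i x = ∏_{l ≠ i} (‖x_i - x_l‖ - ε)(‖x_l - x_i‖ - ε)` of a
  position vector: continuous, measurable, and zero exactly when `i` touches somebody
  (`contactGauge_eq_zero_iff`), so that the contact times of `i` along a good orbit are the zero
  set of a function continuous in time (`collisionTimesOf_eq_setOf_orbitGauge`); `measurable_partner`
  (the partner is a measurable function of the configuration).
* the MEASURABLE STRUCTURE of `LoadedCollisionRecord X N` (port of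
  `HardSphereCollisionRecordMeasurable`): the product σ-algebra transported along the tuple form
  `LoadedCollisionRecord.equivTuple` (`instMeasurableSpace`, `measurableEquivTuple`,
  `measurable_iff_tuple`, `Measurable.loadedCollisionRecord_mk`, measurability of every field and of
  `inDir` / `outDir`, `measurable_ofConfig`); `measurable_loadedImpact` (the impact map is jointly
  measurable in phases, normal and data).
* CONSEQUENCES along the flow (namespace `LoadedSphereFlow`, hypotheses
  `hG : G.IsHardSphereRegular ε`, `hGm : Measurable fun p => G.sepVec p.1 p.2`):
  `measurable_nthCollisionTimeOf`, `measurable_nthContactConfig`, `measurable_nthPartnerOf`,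
  `measurable_flightStartOf`, `measurable_partnerFlightStartOf`, `measurable_nthContactPhases`,
  `measurable_nthContactNormal`, `measurable_nthPostData`, `measurable_nthPreData`,
  `measurable_nthInDir`, `measurable_nthRecordOf`, `measurable_coarsePastOf`,
  `measurable_othersInitialOf`; the σ-algebra
  bounds `coarsePastSigma_le_of_isHardSphereRegular`, `coarsePastOthersSigma_le_of_isHardSphereRegular`;
  the events `measurableSet_hasNthContact`, `measurableSet_isRecontact`, `measurableSet_isShortFlight`,
  `measurableSet_isGrazing`, `measurableSet_isPolar`; and their specialisations to `𝕋³` with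
  `ε < 1/2` (`coarsePastSigma_le_torus`, `coarsePastOthersSigma_le_torus`,
  `measurable_nthContactPhases_torus`, `measurableSet_hasNthContact_not_exceptional_torus`).

## Mathlib / Literature reuse

`measurable_of_tendsto_metrizable`, `measurable_from_prod_countable_left`,
`measurable_of_restrict_of_restrict_compl`, `measurable_of_Iio` / `measurable_of_Ioi`,
`csInf_lt_iff` / `lt_csSup_iff`, `IsCompact.exists_isMinOn`, `exists_rat_btwn`,
`measurable_of_finite`, `Measurable.ite`, `Measurable.inner` are Mathlib's; the dyadic grid
(`HardSphereFlow.tendsto_dyadicUpper`, `HardSphereFlow.measurable_dyadicIndex`) is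
`HardSphereFlowJointMeasurable`'s; right-continuity of loaded trajectories and every object whose
measurability is proved here are `LoadedCollisionRecord`'s. Mathlib's
`measurable_uncurry_of_continuous_of_measurable` needs continuity in the parameter, which loaded
orbits lack (velocities and angular momenta jump), hence the dyadic argument; Mathlib's
hitting-time measurability (`MeasureTheory.Adapted.isStoppingTime_hittingBtwn`, "a discrete
hitting time") is stated for well-founded countable time index sets, hence the direct
countable-sample argument for continuous time here.

## Design choices

* Everything is GLOBAL in the datum thanks to the single cut-off of `Ψ.nthCollisionTimeOf` (junk
  `0` off the good set): on `Ψ.good` the hitting-time lemmas apply to the gauge of the orbit, off it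
  every map is an explicit measurable function of `Ψ_0`.
* Hypotheses are the regular-geometry structure `Geometry.IsHardSphereRegular` (continuity of
  translations and of the separation distance, symmetry of contact) plus measurability of the
  separation map, both available for `ℝ^d` and `𝕋^d` (`Euclidean.isHardSphereRegular_geometry`,
  `Torus.isHardSphereRegular_geometry`, `Euclidean.measurable_geometry_sepVec`,
  `Torus.measurable_geometry_sepVec`).
* Deliberately NOT here: any statement about laws (conditional laws of the phases, frequencies of
  the exceptional classes) — route items.

## References

* I. Gallagher, L. Saint-Raymond, B. Texier, *From Newton to Boltzmann* (2013), §4.1–4.2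
  (collisions of the hard-sphere flow; measurability of flow functionals is implicit whenever they
  are integrated against a law on phase space).
* C. Cercignani, R. Illner, M. Pulvirenti, *The Mathematical Theory of Dilute Gases* (1994), §4.2,
  App. 4.A.
-/

open Set Filter Function MeasureTheory Metric Topology
open scoped InnerProductSpace

namespace Literature.Analysis.FluidPDE

noncomputable section

local notation "E³" => EuclideanSpace ℝ (Fin 3)

/-! ## Hitting times of the zero set of a function continuous in time, measurable in a parameter -/

section Hitting

variable {α : Type*} [MeasurableSpace α] {f : α → ℝ → ℝ}

/-- **The event "`f a` vanishes somewhere on `[p, q]`" is measurable** when `f` is continuous in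
the time variable and measurable in the parameter: by compactness of `[p, q]` and continuity it is
the event "for every `m`, `|f a| < 1/(m+1)` at some point of the countable sample
`p + (q - p)s`, `s ∈ ℚ ∩ [0, 1]`". [folklore] -/
theorem measurableSet_exists_Icc_eq_zero (hc : ∀ a, Continuous (f a))
    (hm : ∀ t, Measurable fun a => f a t) (p q : ℝ) :
    MeasurableSet {a | ∃ t ∈ Icc p q, f a t = 0} := by
  rcases lt_or_ge q p with hqp | hpq
  · have he : {a | ∃ t ∈ Icc p q, f a t = 0} = ∅ := by
      ext a
      simp only [mem_setOf_eq, mem_empty_iff_false, iff_false, not_exists, not_and]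
      intro t ht
      exact absurd (ht.1.trans ht.2) (not_le.2 hqp)
    rw [he]
    exact MeasurableSet.empty
  -- the countable sample of `[p, q]`
  set P : ℚ → ℝ := fun s => p + (q - p) * s with hP
  have hPmem : ∀ θ : ℝ, 0 ≤ θ → θ ≤ 1 → p + (q - p) * θ ∈ Icc p q := fun θ h0 h1 =>
    ⟨by nlinarith [sub_nonneg.2 hpq], by nlinarith [sub_nonneg.2 hpq]⟩
  have key : {a | ∃ t ∈ Icc p q, f a t = 0} =
      ⋂ m : ℕ, ⋃ s : {s : ℚ // (0 : ℚ) ≤ s ∧ s ≤ 1}, {a | |f a (P s)| < 1 / ((m : ℝ) + 1)} := by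
    ext a
    simp only [mem_setOf_eq, mem_iInter, mem_iUnion]
    constructor
    · rintro ⟨t, ht, h0⟩ m
      have hmpos : (0 : ℝ) < 1 / ((m : ℝ) + 1) := by positivity
      obtain ⟨δ, hδ, hδf⟩ := Metric.continuous_iff.1 (hc a) t _ hmpos
      -- a sample point within `δ` of `t`
      obtain ⟨s, hs0, hs1, hst⟩ : ∃ s : ℚ, (0 : ℚ) ≤ s ∧ s ≤ 1 ∧ dist (P s) t < δ := by
        rcases hpq.eq_or_lt with hpq' | hpq'
        · refine ⟨0, le_rfl, zero_le_one, ?_⟩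
          have htp : t = p := le_antisymm (hpq' ▸ ht.2) ht.1
          simp [hP, htp, hδ]
        · have hqp : 0 < q - p := sub_pos.2 hpq'
          set θ : ℝ := (t - p) / (q - p) with hθ
          have hθ0 : 0 ≤ θ := div_nonneg (sub_nonneg.2 ht.1) hqp.le
          have hθ1 : θ ≤ 1 := (div_le_one hqp).2 (by linarith [ht.2])
          have htθ : t = p + (q - p) * θ := by
            rw [hθ, mul_div_cancel₀ _ hqp.ne']
            ring
          set δ' : ℝ := δ / (q - p) with hδ'
          have hδ'pos : 0 < δ' := div_pos hδ hqp
          obtain ⟨s, hs1, hs2⟩ := exists_rat_btwn (show max 0 (θ - δ') < min 1 (θ + δ') from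
            max_lt (lt_min zero_lt_one (by linarith)) (lt_min (by linarith) (by linarith)))
          refine ⟨s, ?_, ?_, ?_⟩
          · exact_mod_cast ((le_max_left _ _).trans_lt hs1).le
          · exact_mod_cast (hs2.trans_le (min_le_left _ _)).le
          · have h1 : θ - δ' < s := (le_max_right _ _).trans_lt hs1
            have h2 : (s : ℝ) < θ + δ' := hs2.trans_le (min_le_right _ _)
            rw [Real.dist_eq, htθ, hP]
            have : p + (q - p) * (s : ℝ) - (p + (q - p) * θ) = (q - p) * (s - θ) := by ring
            rw [this, abs_mul, abs_of_pos hqp]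
            calc (q - p) * |(s : ℝ) - θ| < (q - p) * δ' :=
                  mul_lt_mul_of_pos_left (abs_sub_lt_iff.2 ⟨by linarith, by linarith⟩) hqp
              _ = δ := mul_div_cancel₀ _ hqp.ne'
      refine ⟨⟨s, hs0, hs1⟩, ?_⟩
      have := hδf (P s) hst
      rwa [h0, dist_zero_right, Real.norm_eq_abs] at this
    · intro h
      by_contra hne'
      have hne : ∀ t ∈ Icc p q, f a t ≠ 0 := fun t ht h0 => hne' ⟨t, ht, h0⟩
      -- `|f a|` along the segment is continuous and positive on `[0, 1]`, hence bounded below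
      set g : ℝ → ℝ := fun θ => |f a (p + (q - p) * θ)| with hg
      have hgc : Continuous g := by
        have := hc a
        simp only [hg]
        fun_prop
      obtain ⟨θ₀, hθ₀, hmin⟩ :=
        isCompact_Icc.exists_isMinOn (nonempty_Icc.2 (zero_le_one' ℝ)) hgc.continuousOn
      have hcpos : 0 < g θ₀ := abs_pos.2 (hne _ (hPmem θ₀ hθ₀.1 hθ₀.2))
      obtain ⟨m, hm'⟩ := exists_nat_one_div_lt hcpos
      obtain ⟨⟨s, hs0, hs1⟩, hs⟩ := h m
      have hsK : (s : ℝ) ∈ Icc (0 : ℝ) 1 := ⟨by exact_mod_cast hs0, by exact_mod_cast hs1⟩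
      have hle : g θ₀ ≤ g s := hmin hsK
      have : g s < g θ₀ := lt_trans hs hm'
      exact absurd hle (not_le.2 this)
  rw [key]
  refine MeasurableSet.iInter fun m => MeasurableSet.iUnion fun s => ?_
  exact measurableSet_lt (continuous_abs.measurable.comp (hm (P s))) measurable_const

/-- The event "`f a` vanishes at some time strictly after `σ a`" is measurable. [folklore] -/
theorem measurableSet_exists_Ioi_eq_zero (hc : ∀ a, Continuous (f a))
    (hm : ∀ t, Measurable fun a => f a t) {σ : α → ℝ} (hσ : Measurable σ) :
    MeasurableSet {a | ({t | f a t = 0} ∩ Ioi (σ a)).Nonempty} := by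
  have key : {a | ({t | f a t = 0} ∩ Ioi (σ a)).Nonempty} =
      ⋃ p : ℚ, ⋃ q : ℚ, {a | σ a < p} ∩ {a | ∃ t ∈ Icc (p : ℝ) q, f a t = 0} := by
    ext a
    simp only [mem_setOf_eq, mem_iUnion, mem_inter_iff]
    constructor
    · rintro ⟨t, ht0, hσt⟩
      obtain ⟨p, hp1, hp2⟩ := exists_rat_btwn (mem_Ioi.1 hσt)
      obtain ⟨q, hq1, -⟩ := exists_rat_btwn (lt_add_one t)
      exact ⟨p, q, hp1, t, ⟨hp2.le, hq1.le⟩, ht0⟩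
    · rintro ⟨p, q, hσp, t, ⟨hpt, -⟩, ht0⟩
      exact ⟨t, ht0, mem_Ioi.2 (lt_of_lt_of_le hσp hpt)⟩
  rw [key]
  exact MeasurableSet.iUnion fun p => MeasurableSet.iUnion fun q =>
    (measurableSet_lt hσ measurable_const).inter (measurableSet_exists_Icc_eq_zero hc hm p q)

/-- **The next zero after a measurable time is measurable**: for `f` continuous in time and
measurable in the parameter and `σ` measurable, `a ↦ nextTimeAfter {t | f a t = 0} (σ a)`
(`= sInf` of the zeros after `σ a`, junk `0` if there is none) is measurable. [folklore] -/
theorem measurable_nextTimeAfter_setOf_eq_zero (hc : ∀ a, Continuous (f a))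
    (hm : ∀ t, Measurable fun a => f a t) {σ : α → ℝ} (hσ : Measurable σ) :
    Measurable fun a => nextTimeAfter {t | f a t = 0} (σ a) := by
  have hN := measurableSet_exists_Ioi_eq_zero hc hm hσ
  refine measurable_of_Iio fun c => ?_
  -- the event "some zero lies in `(σ a, c)`"
  have hL : MeasurableSet {a | ∃ t, f a t = 0 ∧ σ a < t ∧ t < c} := by
    have key : {a | ∃ t, f a t = 0 ∧ σ a < t ∧ t < c} =
        ⋃ p : ℚ, ⋃ q : ℚ, {a | σ a < p ∧ (q : ℝ) < c} ∩ {a | ∃ t ∈ Icc (p : ℝ) q, f a t = 0} := by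
      ext a
      simp only [mem_setOf_eq, mem_iUnion, mem_inter_iff]
      constructor
      · rintro ⟨t, ht0, hσt, htc⟩
        obtain ⟨p, hp1, hp2⟩ := exists_rat_btwn hσt
        obtain ⟨q, hq1, hq2⟩ := exists_rat_btwn htc
        exact ⟨p, q, ⟨hp1, hq2⟩, t, ⟨hp2.le, hq1.le⟩, ht0⟩
      · rintro ⟨p, q, ⟨hσp, hqc⟩, t, ⟨hpt, htq⟩, ht0⟩
        exact ⟨t, ht0, lt_of_lt_of_le hσp hpt, lt_of_le_of_lt htq hqc⟩
    rw [key]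
    exact MeasurableSet.iUnion fun p => MeasurableSet.iUnion fun q =>
      ((measurableSet_lt hσ measurable_const).inter (MeasurableSet.const _)).inter
        (measurableSet_exists_Icc_eq_zero hc hm p q)
  have key : (fun a => nextTimeAfter {t | f a t = 0} (σ a)) ⁻¹' Iio c =
      ({a | ({t | f a t = 0} ∩ Ioi (σ a)).Nonempty} ∩ {a | ∃ t, f a t = 0 ∧ σ a < t ∧ t < c}) ∪
        ({a | ({t | f a t = 0} ∩ Ioi (σ a)).Nonempty}ᶜ ∩ {_a | (0 : ℝ) < c}) := by
    ext a
    simp only [mem_preimage, mem_Iio, mem_union, mem_inter_iff, mem_compl_iff, mem_setOf_eq]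
    by_cases hne : ({t | f a t = 0} ∩ Ioi (σ a)).Nonempty
    · have hbdd : BddBelow ({t | f a t = 0} ∩ Ioi (σ a)) := ⟨σ a, fun t ht => le_of_lt ht.2⟩
      rw [nextTimeAfter, csInf_lt_iff hbdd hne]
      constructor
      · rintro ⟨t, ⟨ht0, hσt⟩, htc⟩
        exact Or.inl ⟨hne, t, ht0, hσt, htc⟩
      · rintro (⟨-, t, ht0, hσt, htc⟩ | ⟨hne', -⟩)
        · exact ⟨t, ⟨ht0, hσt⟩, htc⟩
        · exact absurd hne hne'
    · rw [nextTimeAfter_of_eq_empty (not_nonempty_iff_eq_empty.1 hne)]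
      constructor
      · intro h
        exact Or.inr ⟨hne, h⟩
      · rintro (⟨hne', -⟩ | ⟨-, h⟩)
        · exact absurd hne' hne
        · exact h
  rw [key]
  exact (hN.inter hL).union (hN.compl.inter (MeasurableSet.const _))

/-- **The last zero before a measurable time is measurable**: for `f` continuous in time and
measurable in the parameter, `σ` measurable and `a₀` a fixed initial time,
`a ↦ sSup (insert a₀ ({t | f a t = 0} ∩ Ioo a₀ (σ a)))` (the flight-start functional) is
measurable. [folklore] -/
theorem measurable_sSup_insert_setOf_eq_zero (hc : ∀ a, Continuous (f a))
    (hm : ∀ t, Measurable fun a => f a t) (a₀ : ℝ) {σ : α → ℝ} (hσ : Measurable σ) :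
    Measurable fun a => sSup (insert a₀ ({t | f a t = 0} ∩ Ioo a₀ (σ a))) := by
  refine measurable_of_Ioi fun c => ?_
  have hL : MeasurableSet {a | ∃ t, f a t = 0 ∧ a₀ < t ∧ t < σ a ∧ c < t} := by
    have key : {a | ∃ t, f a t = 0 ∧ a₀ < t ∧ t < σ a ∧ c < t} =
        ⋃ p : ℚ, ⋃ q : ℚ, {a | (c < p ∧ a₀ < p) ∧ (q : ℝ) < σ a} ∩
          {a | ∃ t ∈ Icc (p : ℝ) q, f a t = 0} := by
      ext a
      simp only [mem_setOf_eq, mem_iUnion, mem_inter_iff]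
      constructor
      · rintro ⟨t, ht0, h0t, htσ, hct⟩
        obtain ⟨p, hp1, hp2⟩ := exists_rat_btwn (max_lt h0t hct)
        obtain ⟨q, hq1, hq2⟩ := exists_rat_btwn htσ
        exact ⟨p, q, ⟨⟨(le_max_right _ _).trans_lt hp1, (le_max_left _ _).trans_lt hp1⟩, hq2⟩,
          t, ⟨hp2.le, hq1.le⟩, ht0⟩
      · rintro ⟨p, q, ⟨⟨hcp, h0p⟩, hqσ⟩, t, ⟨hpt, htq⟩, ht0⟩
        exact ⟨t, ht0, lt_of_lt_of_le h0p hpt, lt_of_le_of_lt htq hqσ, lt_of_lt_of_le hcp hpt⟩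
    rw [key]
    exact MeasurableSet.iUnion fun p => MeasurableSet.iUnion fun q =>
      ((MeasurableSet.const _).inter (measurableSet_lt measurable_const hσ)).inter
        (measurableSet_exists_Icc_eq_zero hc hm p q)
  have key : (fun a => sSup (insert a₀ ({t | f a t = 0} ∩ Ioo a₀ (σ a)))) ⁻¹' Ioi c =
      {_a | c < a₀} ∪ {a | ∃ t, f a t = 0 ∧ a₀ < t ∧ t < σ a ∧ c < t} := by
    ext a
    have hs : (insert a₀ ({t | f a t = 0} ∩ Ioo a₀ (σ a))).Nonempty := ⟨a₀, mem_insert _ _⟩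
    have hb : BddAbove (insert a₀ ({t | f a t = 0} ∩ Ioo a₀ (σ a))) := by
      refine ⟨max a₀ (σ a), fun x hx => ?_⟩
      rcases mem_insert_iff.1 hx with rfl | hx
      · exact le_max_left _ _
      · exact (le_of_lt hx.2.2).trans (le_max_right _ _)
    simp only [mem_preimage, mem_Ioi, mem_union, mem_setOf_eq]
    rw [lt_csSup_iff hb hs]
    constructor
    · rintro ⟨b, hb', hcb⟩
      rcases mem_insert_iff.1 hb' with rfl | ⟨hb0, hb1, hb2⟩
      · exact Or.inl hcb
      · exact Or.inr ⟨b, hb0, hb1, hb2, hcb⟩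
    · rintro (h | ⟨t, ht0, h1, h2, hct⟩)
      · exact ⟨a₀, mem_insert _ _, h⟩
      · exact ⟨t, mem_insert_of_mem _ ⟨ht0, h1, h2⟩, hct⟩
  rw [key]
  exact (MeasurableSet.const _).union hL

end Hitting

/-! ## The participation gauge of a position vector -/

section Gauge

variable {d : Type*} [Fintype d] {X : Type*} {N : ℕ}

/-- The **participation gauge** of particle `i` in the position vector `x`:
`∏_{l ≠ i} (‖x_i - x_l‖ - ε)(‖x_l - x_i‖ - ε)` — zero exactly when some sphere `l ≠ i` touches
sphere `i` (in either order of the separation map), a polynomial in the pair distances and hence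
continuous / measurable when they are. [folklore] -/
def contactGauge (G : Geometry d X) (ε : ℝ) (i : Fin N) (x : Fin N → X) : ℝ :=
  ∏ l, if l = i then 1 else (‖G.sepVec (x i) (x l)‖ - ε) * (‖G.sepVec (x l) (x i)‖ - ε)

variable {G : Geometry d X} {ε : ℝ}

/-- **The gauge vanishes iff the particle participates in a contact** (configurations of the
hard-sphere domain). [folklore] -/
theorem contactGauge_eq_zero_iff {z : Config N d X} (hz : z ∈ hardSphereDomain G N ε) (i : Fin N) :
    contactGauge G ε i (fun k => (z k).1) = 0 ↔ Participates G ε z i := by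
  rw [contactGauge, Finset.prod_eq_zero_iff]
  constructor
  · rintro ⟨l, -, hl⟩
    by_cases hli : l = i
    · simp [hli] at hl
    · rw [if_neg hli, mul_eq_zero, sub_eq_zero, sub_eq_zero] at hl
      rcases hl with h | h
      · exact ⟨l, Or.inl (mem_contactPairs.2 ⟨Ne.symm hli, mem_contactSet.2 ⟨hz, h⟩⟩)⟩
      · exact ⟨l, Or.inr (mem_contactPairs.2 ⟨hli, mem_contactSet.2 ⟨hz, h⟩⟩)⟩
  · rintro ⟨l, h | h⟩
    · obtain ⟨hil, hc⟩ := mem_contactPairs.1 h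
      refine ⟨l, Finset.mem_univ l, ?_⟩
      rw [if_neg (Ne.symm hil), mul_eq_zero]
      exact Or.inl (sub_eq_zero.2 (mem_contactSet.1 hc).2)
    · obtain ⟨hli, hc⟩ := mem_contactPairs.1 h
      refine ⟨l, Finset.mem_univ l, ?_⟩
      rw [if_neg hli, mul_eq_zero]
      exact Or.inr (sub_eq_zero.2 (mem_contactSet.1 hc).2)

/-- The gauge is continuous in the positions when the separation distance is. [folklore] -/
theorem continuous_contactGauge [TopologicalSpace X]
    (hG : Continuous fun p : X × X => ‖G.sepVec p.1 p.2‖) (i : Fin N) :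
    Continuous (contactGauge (N := N) G ε i) := by
  unfold contactGauge
  refine continuous_finsetProd _ fun l _ => ?_
  by_cases hli : l = i
  · simp only [hli, if_true]
    exact continuous_const
  · simp only [hli, if_false]
    -- (elaborating `hG.comp _` against the goal directly makes the unifier time out, as in
    -- `Geometry.IsHardSphereRegular.continuous_norm_sepVec_config`; go through `Function.comp_def`)
    have hil : Continuous fun x : Fin N → X => (x i, x l) := by fun_prop
    have hli' : Continuous fun x : Fin N → X => (x l, x i) := by fun_prop
    have h1 : Continuous fun x : Fin N → X => ‖G.sepVec (x i) (x l)‖ := by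
      simpa only [Function.comp_def] using hG.comp hil
    have h2 : Continuous fun x : Fin N → X => ‖G.sepVec (x l) (x i)‖ := by
      simpa only [Function.comp_def] using hG.comp hli'
    exact (h1.sub continuous_const).mul (h2.sub continuous_const)

/-- The gauge is measurable in the positions when the separation map is. [folklore] -/
theorem measurable_contactGauge [MeasurableSpace X]
    (hG : Measurable fun p : X × X => G.sepVec p.1 p.2) (i : Fin N) :
    Measurable (contactGauge (N := N) G ε i) := by
  unfold contactGauge
  refine Finset.measurable_prod _ fun l _ => ?_
  by_cases hli : l = i
  · simp only [hli, if_true]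
    exact measurable_const
  · simp only [hli, if_false]
    have hil : Measurable fun x : Fin N → X => (x i, x l) :=
      (measurable_pi_apply i).prodMk (measurable_pi_apply l)
    have hli' : Measurable fun x : Fin N → X => (x l, x i) :=
      (measurable_pi_apply l).prodMk (measurable_pi_apply i)
    have h1 : Measurable fun x : Fin N → X => G.sepVec (x i) (x l) := by
      simpa only [Function.comp_def] using hG.comp hil
    have h2 : Measurable fun x : Fin N → X => G.sepVec (x l) (x i) := by
      simpa only [Function.comp_def] using hG.comp hli'
    exact (h1.norm.sub_const ε).mul (h2.norm.sub_const ε)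

/-- The event "`i` and `l` collide" is measurable in the configuration. [folklore] -/
theorem measurableSet_collide [MeasurableSpace X] (hG : Measurable fun p : X × X => G.sepVec p.1 p.2)
    (i l : Fin N) : MeasurableSet {z : Config N d X | Collide G ε z i l} := by
  have h : ∀ a b : Fin N, MeasurableSet {z : Config N d X | (a, b) ∈ contactPairs G ε z} := by
    intro a b
    have : {z : Config N d X | (a, b) ∈ contactPairs G ε z} = {z | a ≠ b ∧ z ∈ contactSet G N ε a b} := by
      ext z
      exact mem_contactPairs
    rw [this]
    exact (MeasurableSet.const _).inter (measurableSet_contactSet G hG N ε a b)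
  exact (h i l).union (h l i)

open scoped Classical in
/-- The least index of `Fin N` satisfying a predicate, or `i` if there is none (the combinatorial
skeleton of `partner`). [folklore] -/
def leastOrSelf (i : Fin N) (v : Fin N → Prop) : Fin N :=
  if h : (Finset.univ.filter v).Nonempty then (Finset.univ.filter v).min' h else i

/-- The partner is the least collider, or the particle itself: `partner` factors through the
finite truth table of `Collide`. [folklore] -/
theorem partner_eq_leastOrSelf (z : Config N d X) (i : Fin N) :
    partner G ε z i = leastOrSelf i fun l => Collide G ε z i l :=
  rfl

/-- **The partner is a measurable function of the configuration** (measurable separation map):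
it factors through the finitely many measurable events `Collide … i l`. [folklore] -/
theorem measurable_partner [MeasurableSpace X] (hG : Measurable fun p : X × X => G.sepVec p.1 p.2)
    (i : Fin N) : Measurable fun z : Config N d X => partner G ε z i := by
  have hb : Measurable fun z : Config N d X => fun l => Collide G ε z i l :=
    measurable_pi_lambda _ fun l => measurableSet_setOf.1 (measurableSet_collide hG i l)
  exact (measurable_of_finite (leastOrSelf i)).comp hb

end Gauge

/-! ## Two measurable selections -/

section Select

variable {α : Type*} [MeasurableSpace α] {N : ℕ}

/-- Evaluating a measurable `Fin N`-indexed family at a measurable random index is measurable.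
[folklore] -/
theorem measurable_apply_random {β : Type*} [MeasurableSpace β] {w : α → Fin N → β}
    {J : α → Fin N} (hw : Measurable w) (hJ : Measurable J) : Measurable fun a => w a (J a) := by
  have h : Measurable fun p : (Fin N → β) × Fin N => p.1 p.2 :=
    measurable_from_prod_countable_left fun j => measurable_pi_apply j
  exact h.comp (hw.prodMk hJ)

/-- A real functional depending measurably on the parameter for each index is measurable at a
measurable random index. [folklore] -/
theorem measurable_select {F : α → Fin N → ℝ} {J : α → Fin N} (hF : ∀ j, Measurable fun a => F a j)
    (hJ : Measurable J) : Measurable fun a => F a (J a) := by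
  have h : Measurable fun p : α × Fin N => F p.1 p.2 := measurable_from_prod_countable_left hF
  exact h.comp (measurable_id.prodMk hJ)

end Select

/-! ## The impact map is measurable in all its arguments -/

section Impact

/-- The approach speed is a jointly continuous function of the phases, the normal and the pair
data. [folklore] -/
theorem continuous_approachSpeed_tuple (ε ξ ι : ℝ) :
    Continuous fun v : (E³ × E³ × E³) × ((E³ × E³) × (E³ × E³)) =>
      approachSpeed ε ξ ι v.1.1 v.1.2.1 v.1.2.2 v.2 := by
  unfold approachSpeed
  simp only [← crossCLM_apply]
  fun_prop

/-- The impulse denominator is a jointly continuous function of the phases and the normal.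
[folklore] -/
theorem continuous_impactDenom_tuple (ξ ι : ℝ) :
    Continuous fun v : (E³ × E³ × E³) × ((E³ × E³) × (E³ × E³)) =>
      impactDenom ξ ι v.1.1 v.1.2.1 v.1.2.2 := by
  unfold impactDenom
  fun_prop

/-- The impulse is a jointly measurable function of the phases, the normal and the pair data (a
quotient of continuous functions; `Measurable.div`, no nonvanishing needed). [folklore] -/
theorem measurable_impulse_tuple (ε ξ ι : ℝ) :
    Measurable fun v : (E³ × E³ × E³) × ((E³ × E³) × (E³ × E³)) =>
      impulse ε ξ ι v.1.1 v.1.2.1 v.1.2.2 v.2 := by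
  unfold impulse
  exact ((continuous_approachSpeed_tuple ε ξ ι).measurable.const_mul _).div
    (continuous_impactDenom_tuple ξ ι).measurable

/-- **The impact map `loadedImpact ε ξ ι a_i a_j n p` is a jointly measurable function of the
phases, the normal and the pair data.** [folklore] -/
theorem measurable_loadedImpact (ε ξ ι : ℝ) :
    Measurable fun v : (E³ × E³ × E³) × ((E³ × E³) × (E³ × E³)) =>
      loadedImpact ε ξ ι v.1.1 v.1.2.1 v.1.2.2 v.2 := by
  have hJ := measurable_impulse_tuple ε ξ ι
  have hcm : Measurable fun p : E³ × E³ => cross p.1 p.2 := by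
    simp only [← crossCLM_apply]
    fun_prop
  unfold loadedImpact
  fun_prop

/-- The normalised separation `‖sep(y, x)‖⁻¹ • sep(y, x)` is a measurable function of the pair of
positions `(x, y)` (measurable separation map): the kernel of `loadedNormal`. [folklore] -/
theorem measurable_normalisedSep {X : Type*} [MeasurableSpace X] {G : Geometry (Fin 3) X}
    (hG : Measurable fun p : X × X => G.sepVec p.1 p.2) :
    Measurable fun p : X × X => ‖G.sepVec p.2 p.1‖⁻¹ • G.sepVec p.2 p.1 := by
  have h : Measurable fun p : X × X => G.sepVec p.2 p.1 := by
    simpa only [Function.comp_def, Prod.fst_swap, Prod.snd_swap] using hG.comp measurable_swap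
  exact h.norm.inv.smul h

end Impact

/-! ## The measurable structure of loaded collision records -/

namespace LoadedCollisionRecord

variable {X : Type*} {N : ℕ}

/-- The product type carrying the tuple form of a loaded collision record:
`(t, (i, j), (X_i, X_j), n, (a_i, a_j), preData, postData)`. [folklore] -/
abbrev Tuple (X : Type*) (N : ℕ) : Type _ :=
  ℝ × (Fin N × Fin N) × (X × X) × E³ × (E³ × E³) × ((E³ × E³) × (E³ × E³)) ×
    ((E³ × E³) × (E³ × E³))

/-- The tuple form of a record. [folklore] -/
def toTuple (c : LoadedCollisionRecord X N) : Tuple X N :=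
  (c.time, (c.fst, c.snd), (c.fstPos, c.sndPos), c.normal, c.phases, c.preData, c.postData)

/-- The record with a given tuple form. [folklore] -/
def ofTuple (p : Tuple X N) : LoadedCollisionRecord X N :=
  ⟨p.1, p.2.1.1, p.2.1.2, p.2.2.1.1, p.2.2.1.2, p.2.2.2.1, p.2.2.2.2.1, p.2.2.2.2.2.1, p.2.2.2.2.2.2⟩

/-- **Records are tuples**: the bijection between loaded collision records and their tuple forms.
[folklore] -/
def equivTuple : LoadedCollisionRecord X N ≃ Tuple X N where
  toFun := toTuple
  invFun := ofTuple
  left_inv _ := rfl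
  right_inv _ := rfl

/-- Unfolding lemma for the tuple form. [folklore] -/
@[simp]
theorem equivTuple_apply (c : LoadedCollisionRecord X N) :
    equivTuple c = (c.time, (c.fst, c.snd), (c.fstPos, c.sndPos), c.normal, c.phases, c.preData,
      c.postData) :=
  rfl

/-- Unfolding lemma for the inverse of the tuple form. [folklore] -/
@[simp]
theorem equivTuple_symm_apply (p : Tuple X N) :
    equivTuple.symm p = (⟨p.1, p.2.1.1, p.2.1.2, p.2.2.1.1, p.2.2.1.2, p.2.2.2.1, p.2.2.2.2.1,
      p.2.2.2.2.2.1, p.2.2.2.2.2.2⟩ : LoadedCollisionRecord X N) :=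
  rfl

/-- **The σ-algebra of loaded collision records**: the product σ-algebra (Borel on time, normal,
phases and data, discrete on the labels, the given one on positions) transported along the tuple
form — the pattern of `HardSphereCollisionRecord.instMeasurableSpace`. [folklore] -/
instance instMeasurableSpace [MeasurableSpace X] : MeasurableSpace (LoadedCollisionRecord X N) :=
  MeasurableSpace.comap equivTuple inferInstance

variable [MeasurableSpace X]

/-- The tuple form is measurable (by construction). [folklore] -/
theorem measurable_equivTuple : Measurable (equivTuple : LoadedCollisionRecord X N → Tuple X N) :=
  comap_measurable _

/-- **A record-valued map is measurable iff its tuple form is.** [folklore] -/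
theorem measurable_iff_tuple {α : Type*} [MeasurableSpace α] {f : α → LoadedCollisionRecord X N} :
    Measurable f ↔ Measurable (equivTuple ∘ f) := by
  rw [measurable_iff_comap_le, measurable_iff_comap_le, instMeasurableSpace,
    MeasurableSpace.comap_comp]

/-- The inverse of the tuple form is measurable. [folklore] -/
theorem measurable_equivTuple_symm :
    Measurable (equivTuple.symm : Tuple X N → LoadedCollisionRecord X N) :=
  measurable_iff_tuple.2 (by rw [Equiv.self_comp_symm]; exact measurable_id)

/-- **Records are tuples, measurably**: the tuple form as a measurable equivalence. [folklore] -/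
def measurableEquivTuple : LoadedCollisionRecord X N ≃ᵐ Tuple X N where
  toEquiv := equivTuple
  measurable_toFun := measurable_equivTuple
  measurable_invFun := measurable_equivTuple_symm

/-- The measurable equivalence is the tuple form. [folklore] -/
@[simp]
theorem coe_measurableEquivTuple :
    ⇑(measurableEquivTuple : LoadedCollisionRecord X N ≃ᵐ Tuple X N) = equivTuple :=
  rfl

/-- **Building measurable record-valued maps**: a map into records all of whose fields are
measurable is measurable. Deliberately declared in Mathlib's `Measurable` namespace as a
dot-notation extension (like `Measurable.hardSphereCollisionRecord_mk`). [folklore] -/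
theorem _root_.Measurable.loadedCollisionRecord_mk {α : Type*} [MeasurableSpace α] {t : α → ℝ}
    {i j : α → Fin N} {x y : α → X} {nr : α → E³} {ph : α → E³ × E³}
    {u w : α → (E³ × E³) × (E³ × E³)} (ht : Measurable t) (hi : Measurable i) (hj : Measurable j)
    (hx : Measurable x) (hy : Measurable y) (hn : Measurable nr) (hph : Measurable ph)
    (hu : Measurable u) (hw : Measurable w) :
    Measurable fun a => (⟨t a, i a, j a, x a, y a, nr a, ph a, u a, w a⟩ : LoadedCollisionRecord X N) :=
  measurable_iff_tuple.2
    (ht.prodMk ((hi.prodMk hj).prodMk ((hx.prodMk hy).prodMk (hn.prodMk (hph.prodMk (hu.prodMk hw))))))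

/-- The contact time is a measurable function of the record. [folklore] -/
theorem measurable_time : Measurable fun c : LoadedCollisionRecord X N => c.time :=
  measurable_fst.comp measurable_equivTuple

/-- The ordered colliding pair is a measurable function of the record. [folklore] -/
theorem measurable_indices : Measurable fun c : LoadedCollisionRecord X N => (c.fst, c.snd) :=
  measurable_snd.fst.comp measurable_equivTuple

/-- The pair of geometric centres is a measurable function of the record. [folklore] -/
theorem measurable_positions : Measurable fun c : LoadedCollisionRecord X N => (c.fstPos, c.sndPos) :=
  measurable_snd.snd.fst.comp measurable_equivTuple

/-- The contact normal is a measurable function of the record. [folklore] -/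
theorem measurable_normal : Measurable fun c : LoadedCollisionRecord X N => c.normal :=
  measurable_snd.snd.snd.fst.comp measurable_equivTuple

/-- The contact phases are a measurable function of the record. [folklore] -/
theorem measurable_phases : Measurable fun c : LoadedCollisionRecord X N => c.phases :=
  measurable_snd.snd.snd.snd.fst.comp measurable_equivTuple

/-- The incoming data are a measurable function of the record. [folklore] -/
theorem measurable_preData : Measurable fun c : LoadedCollisionRecord X N => c.preData :=
  measurable_snd.snd.snd.snd.snd.fst.comp measurable_equivTuple

/-- The outgoing data are a measurable function of the record. [folklore] -/
theorem measurable_postData : Measurable fun c : LoadedCollisionRecord X N => c.postData :=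
  measurable_snd.snd.snd.snd.snd.snd.comp measurable_equivTuple

/-- The incoming relative direction `ĝ` is a measurable function of the record. [folklore] -/
theorem measurable_inDir : Measurable fun c : LoadedCollisionRecord X N => c.inDir := by
  have h : Measurable fun c : LoadedCollisionRecord X N => c.preData.1.1 - c.preData.1.2 :=
    measurable_preData.fst.fst.sub measurable_preData.fst.snd
  exact h.norm.inv.smul h

/-- The outgoing relative direction is a measurable function of the record. [folklore] -/
theorem measurable_outDir : Measurable fun c : LoadedCollisionRecord X N => c.outDir := by
  have h : Measurable fun c : LoadedCollisionRecord X N => c.postData.1.1 - c.postData.1.2 :=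
    measurable_postData.fst.fst.sub measurable_postData.fst.snd
  exact h.norm.inv.smul h

/-- **The record of `(i, j)` at time `t` is a measurable function of the loaded configuration**,
for a geometry whose separation map is jointly measurable. [folklore] -/
theorem measurable_ofConfig {G : Geometry (Fin 3) X} (hG : Measurable fun q : X × X => G.sepVec q.1 q.2)
    (ε ξ ι : ℝ) (t : ℝ) (i j : Fin N) :
    Measurable fun z : LoadedConfig N X => ofConfig G ε ξ ι z t i j := by
  have hzi : Measurable fun z : LoadedConfig N X => z i := measurable_pi_apply i
  have hzj : Measurable fun z : LoadedConfig N X => z j := measurable_pi_apply j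
  have hnorm : Measurable fun z : LoadedConfig N X => loadedNormal G z i j := by
    have h := (measurable_normalisedSep hG).comp (hzi.fst.fst.prodMk hzj.fst.fst)
    simp only [loadedNormal]
    simpa only [Function.comp_def] using h
  have hpair : Measurable fun z : LoadedConfig N X => loadedPairData z i j :=
    (hzi.fst.snd.prodMk hzj.fst.snd).prodMk (hzi.snd.snd.prodMk hzj.snd.snd)
  have hpre : Measurable fun z : LoadedConfig N X => loadedPostData G ε ξ ι z i j := by
    have h := (measurable_loadedImpact ε ξ ι).comp
      ((hzi.snd.fst.prodMk (hzj.snd.fst.prodMk hnorm)).prodMk hpair)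
    simp only [loadedPostData]
    simpa only [Function.comp_def] using h
  exact measurable_const.loadedCollisionRecord_mk measurable_const measurable_const hzi.fst.fst
    hzj.fst.fst hnorm (hzi.snd.fst.prodMk hzj.snd.fst) hpre hpair

end LoadedCollisionRecord

/-- Pointwise continuity of translations from the regular-geometry structure (private copy of the
tree's `Geometry.IsHardSphereRegular.continuous_translate_left`, `HardSphereFlowGroup.lean`, whose
import closure — Alexander's construction — is foreign to this file). [folklore] -/
private theorem regular_continuous_translate {d : Type*} [Fintype d] {X : Type*}
    [TopologicalSpace X] {G : Geometry d X} {ε : ℝ} (hG : G.IsHardSphereRegular ε) (x : X) :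
    Continuous (G.translate x) :=
  hG.continuous_translate.comp (continuous_const.prodMk continuous_id)

/-! ## Along the loaded-sphere flow -/

namespace LoadedSphereFlow

variable {X : Type*} [MeasureSpace X] [TopologicalSpace X] {N : ℕ} {G : Geometry (Fin 3) X}
  {ε ξ ι : ℝ} (Ψ : LoadedSphereFlow G ε ξ ι N)

/-! ### The gauge along a good orbit -/

/-- The participation gauge of `i` along the orbit of a good datum, as a function of time. [folklore] -/
def orbitGauge (Ψ : LoadedSphereFlow G ε ξ ι N) (i : Fin N) (z : Ψ.good) (t : ℝ) : ℝ :=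
  contactGauge G ε i fun k => (Ψ.flow t (z : LoadedConfig N X) k).1.1

/-- The gauge along a good orbit is continuous in time (geometric centres are continuous,
separation distance is continuous). [folklore] -/
theorem continuous_orbitGauge (hGc : Continuous fun p : X × X => ‖G.sepVec p.1 p.2‖) (i : Fin N)
    (z : Ψ.good) : Continuous (Ψ.orbitGauge i z) :=
  (continuous_contactGauge hGc i).comp
    (continuous_pi fun k => (Ψ.isTrajectory (z : LoadedConfig N X) z.2).pos_continuous k)

/-- The gauge along the orbit at a fixed time is measurable in the datum. [folklore] -/
theorem measurable_orbitGauge (hGm : Measurable fun p : X × X => G.sepVec p.1 p.2) (i : Fin N)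
    (t : ℝ) : Measurable fun z : Ψ.good => Ψ.orbitGauge i z t :=
  (measurable_contactGauge hGm i).comp
    ((measurable_pi_lambda _ fun k => (measurable_pi_apply k).fst.fst).comp
      ((Ψ.measurable_flow t).comp measurable_subtype_coe))

/-- **The contact times of `i` along a good orbit are the zero set of the gauge.** [folklore] -/
theorem collisionTimesOf_eq_setOf_orbitGauge (i : Fin N) (z : Ψ.good) :
    collisionTimesOf G ε (fun t => loadedProjection (Ψ.flow t (z : LoadedConfig N X))) i =
      {t | Ψ.orbitGauge i z t = 0} := by
  ext t
  rw [mem_collisionTimesOf, mem_setOf_eq]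
  exact (contactGauge_eq_zero_iff
    ((Ψ.isTrajectory (z : LoadedConfig N X) z.2).loadedProjection_mem t) i).symm

/-! ### Contact times and partners -/

/-- **The `n`-th contact time of `i` is a measurable function of the initial datum** (continuous
separation distance, measurable separation map): on the good set by the hitting-time lemma applied
inductively to the gauge of the orbit, off it the constant `0`. [folklore] -/
theorem measurable_nthCollisionTimeOf (hGc : Continuous fun p : X × X => ‖G.sepVec p.1 p.2‖)
    (hGm : Measurable fun p : X × X => G.sepVec p.1 p.2) (i : Fin N) (n : ℕ) :
    Measurable (Ψ.nthCollisionTimeOf i n) := by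
  have hc := Ψ.continuous_orbitGauge hGc i
  have hm := Ψ.measurable_orbitGauge hGm i
  have hgood : ∀ n, Measurable fun z : Ψ.good => Ψ.nthCollisionTimeOf i n z := by
    intro n
    induction n with
    | zero =>
      have h : (fun z : Ψ.good => Ψ.nthCollisionTimeOf i 0 z) =
          fun z => nextTimeAfter {t | Ψ.orbitGauge i z t = 0} ((fun _ => (0 : ℝ)) z) := by
        funext z
        rw [Ψ.nthCollisionTimeOf_zero z.2, Ψ.collisionTimesOf_eq_setOf_orbitGauge i z]
      rw [h]
      exact measurable_nextTimeAfter_setOf_eq_zero hc hm measurable_const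
    | succ n ih =>
      have h : (fun z : Ψ.good => Ψ.nthCollisionTimeOf i (n + 1) z) =
          fun z => nextTimeAfter {t | Ψ.orbitGauge i z t = 0} (Ψ.nthCollisionTimeOf i n z) := by
        funext z
        rw [Ψ.nthCollisionTimeOf_succ z.2, Ψ.collisionTimesOf_eq_setOf_orbitGauge i z]
      rw [h]
      exact measurable_nextTimeAfter_setOf_eq_zero hc hm ih
  refine measurable_of_restrict_of_restrict_compl Ψ.measurableSet_good (hgood n) ?_
  have h : (Ψ.goodᶜ).restrict (Ψ.nthCollisionTimeOf i n) = fun _ => 0 := by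
    funext z
    exact Ψ.nthCollisionTimeOf_of_not_mem z.2 i n
  rw [h]
  exact measurable_const

/-- The flight-start functional of particle `j` at the `n`-th contact time of `i` is measurable on
the good set. [folklore] -/
theorem measurable_flightStart_good (hGc : Continuous fun p : X × X => ‖G.sepVec p.1 p.2‖)
    (hGm : Measurable fun p : X × X => G.sepVec p.1 p.2) (i j : Fin N) (n : ℕ) :
    Measurable fun z : Ψ.good =>
      flightStart G ε (fun t => loadedProjection (Ψ.flow t (z : LoadedConfig N X))) 0 j
        (Ψ.nthCollisionTimeOf i n z) := by
  have h : (fun z : Ψ.good =>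
      flightStart G ε (fun t => loadedProjection (Ψ.flow t (z : LoadedConfig N X))) 0 j
        (Ψ.nthCollisionTimeOf i n z)) =
      fun z => sSup (insert 0 ({t | Ψ.orbitGauge j z t = 0} ∩ Ioo 0 (Ψ.nthCollisionTimeOf i n z))) := by
    funext z
    rw [flightStart, Ψ.collisionTimesOf_eq_setOf_orbitGauge j z]
  rw [h]
  exact measurable_sSup_insert_setOf_eq_zero (Ψ.continuous_orbitGauge hGc j)
    (Ψ.measurable_orbitGauge hGm j) 0
    ((Ψ.measurable_nthCollisionTimeOf hGc hGm i n).comp measurable_subtype_coe)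

/-- **The flight start of `i` is a measurable function of the initial datum.** [folklore] -/
theorem measurable_flightStartOf (hGc : Continuous fun p : X × X => ‖G.sepVec p.1 p.2‖)
    (hGm : Measurable fun p : X × X => G.sepVec p.1 p.2) (i : Fin N) (n : ℕ) :
    Measurable (Ψ.flightStartOf i n) := by
  refine measurable_of_restrict_of_restrict_compl Ψ.measurableSet_good
    (Ψ.measurable_flightStart_good hGc hGm i i n) ?_
  have h : (Ψ.goodᶜ).restrict (Ψ.flightStartOf i n) = fun _ => 0 := by
    funext z
    exact Ψ.flightStartOf_of_not_mem z.2 i n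
  rw [h]
  exact measurable_const

/-- The event "the `n`-th contact of `i` exists" is measurable. [folklore] -/
theorem measurableSet_hasNthContact (hG : G.IsHardSphereRegular ε)
    (hGm : Measurable fun p : X × X => G.sepVec p.1 p.2) (i : Fin N) (n : ℕ) :
    MeasurableSet {z | Ψ.HasNthContact i n z} := by
  have hτ := fun m => Ψ.measurable_nthCollisionTimeOf hG.continuous_norm_sepVec hGm i m
  have h : {z | Ψ.HasNthContact i n z} = Ψ.good ∩ {z | 0 < Ψ.nthCollisionTimeOf i 0 z} ∩
      ⋂ m : Fin n, {z | Ψ.nthCollisionTimeOf i m z < Ψ.nthCollisionTimeOf i (m + 1) z} := by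
    ext z
    simp only [HasNthContact, mem_setOf_eq, mem_inter_iff, mem_iInter]
    constructor
    · rintro ⟨hz, h0, hlt⟩
      exact ⟨⟨hz, h0⟩, fun m => hlt m m.2⟩
    · rintro ⟨⟨hz, h0⟩, hlt⟩
      exact ⟨hz, h0, fun m hm => hlt ⟨m, hm⟩⟩
  rw [h]
  exact (Ψ.measurableSet_good.inter (measurableSet_lt measurable_const (hτ 0))).inter
    (MeasurableSet.iInter fun m => measurableSet_lt (hτ m) (hτ (m + 1)))

section Borel

variable [TopologicalSpace.PseudoMetrizableSpace X] [SecondCountableTopology X] [BorelSpace X]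

/-! ### Joint measurability of the loaded flow on its good set -/

/-- **Joint measurability of the loaded-sphere flow on its good set.** For a loaded flow on a
metrisable, second-countable, Borel position space with continuous translations (`ℝ³`, `𝕋³`), the
map `(z, s) ↦ Ψ_s z` is measurable on `Ψ.good × ℝ`: `Ψ_s z` is the limit of `Ψ_{d_n(s)} z` along the
dyadic grid points `d_n(s) ↓ s` (orbits of good data are right-continuous,
`IsLoadedSphereTrajectory.tendsto_nhdsGT`), and each approximant factors through the countable-valued
measurable index `⌊2ⁿ s⌋`. [folklore] -/
theorem measurable_flow_prod (hGt : ∀ x : X, Continuous (G.translate x)) :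
    Measurable fun p : Ψ.good × ℝ => Ψ.flow p.2 (p.1 : LoadedConfig N X) := by
  let u : ℕ → Ψ.good × ℝ → LoadedConfig N X := fun n p =>
    Ψ.flow (((⌊p.2 * 2 ^ n⌋ + 1 : ℤ) : ℝ) / 2 ^ n) p.1
  have hu : ∀ n, Measurable (u n) := by
    intro n
    have hg : Measurable fun q : Ψ.good × ℤ =>
        Ψ.flow (((q.2 + 1 : ℤ) : ℝ) / 2 ^ n) (q.1 : LoadedConfig N X) :=
      measurable_from_prod_countable_left fun k => by
        change Measurable fun x : Ψ.good => Ψ.flow (((k + 1 : ℤ) : ℝ) / 2 ^ n) (x : LoadedConfig N X)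
        exact (Ψ.measurable_flow _).comp measurable_subtype_coe
    exact hg.comp (measurable_fst.prodMk ((HardSphereFlow.measurable_dyadicIndex n).comp
      measurable_snd))
  refine measurable_of_tendsto_metrizable hu ?_
  rw [tendsto_pi_nhds]
  rintro ⟨z, s⟩
  exact ((Ψ.isTrajectory (z : LoadedConfig N X) z.2).tendsto_nhdsGT hGt s).comp
    (HardSphereFlow.tendsto_dyadicUpper s)

/-- **The flow at a measurable random time is measurable**, for a measurable time functional `σ`
vanishing off the good set (where `Ψ_0` is measurable by hypothesis). [folklore] -/
theorem measurable_flow_at (hGt : ∀ x : X, Continuous (G.translate x)) {σ : LoadedConfig N X → ℝ}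
    (hσ : Measurable σ) (h0 : ∀ z ∉ Ψ.good, σ z = 0) : Measurable fun z => Ψ.flow (σ z) z := by
  refine measurable_of_restrict_of_restrict_compl Ψ.measurableSet_good ?_ ?_
  · exact (Ψ.measurable_flow_prod hGt).comp (measurable_id.prodMk (hσ.comp measurable_subtype_coe))
  · have h : (Ψ.goodᶜ).restrict (fun z => Ψ.flow (σ z) z) =
        fun z : (Ψ.goodᶜ : Set (LoadedConfig N X)) => Ψ.flow 0 (z : LoadedConfig N X) := by
      funext z
      simp only [restrict_apply, h0 z z.2]
    rw [h]
    exact (Ψ.measurable_flow 0).comp measurable_subtype_coe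

/-! ### The configuration, the partner and the flight starts of the `n`-th contact -/

/-- **The configuration at the `n`-th contact of `i` is a measurable function of the datum.**
[folklore] -/
theorem measurable_nthContactConfig (hG : G.IsHardSphereRegular ε)
    (hGm : Measurable fun p : X × X => G.sepVec p.1 p.2) (i : Fin N) (n : ℕ) :
    Measurable (Ψ.nthContactConfig i n) :=
  Ψ.measurable_flow_at (regular_continuous_translate hG)
    (Ψ.measurable_nthCollisionTimeOf hG.continuous_norm_sepVec hGm i n)
    fun _ hz => Ψ.nthCollisionTimeOf_of_not_mem hz i n

/-- **The `n`-th partner of `i` is a measurable function of the datum.** [folklore] -/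
theorem measurable_nthPartnerOf (hG : G.IsHardSphereRegular ε)
    (hGm : Measurable fun p : X × X => G.sepVec p.1 p.2) (i : Fin N) (n : ℕ) :
    Measurable (Ψ.nthPartnerOf i n) :=
  (measurable_partner hGm i).comp
    (measurable_loadedProjection.comp (Ψ.measurable_nthContactConfig hG hGm i n))

/-- **The flight start of the partner is a measurable function of the datum** (a measurable
selection among the `N` flight-start functionals by the measurable partner). [folklore] -/
theorem measurable_partnerFlightStartOf (hG : G.IsHardSphereRegular ε)
    (hGm : Measurable fun p : X × X => G.sepVec p.1 p.2) (i : Fin N) (n : ℕ) :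
    Measurable (Ψ.partnerFlightStartOf i n) := by
  refine measurable_of_restrict_of_restrict_compl Ψ.measurableSet_good ?_ ?_
  · exact measurable_select
      (fun j => Ψ.measurable_flightStart_good hG.continuous_norm_sepVec hGm i j n)
      ((Ψ.measurable_nthPartnerOf hG hGm i n).comp measurable_subtype_coe)
  · have h : (Ψ.goodᶜ).restrict (Ψ.partnerFlightStartOf i n) = fun _ => 0 := by
      funext z
      exact Ψ.partnerFlightStartOf_of_not_mem z.2 i n
    rw [h]
    exact measurable_const

/-- The configuration at the flight start of `i` is a measurable function of the datum. [folklore] -/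
theorem measurable_flow_flightStartOf (hG : G.IsHardSphereRegular ε)
    (hGm : Measurable fun p : X × X => G.sepVec p.1 p.2) (i : Fin N) (n : ℕ) :
    Measurable fun z => Ψ.flow (Ψ.flightStartOf i n z) z :=
  Ψ.measurable_flow_at (regular_continuous_translate hG)
    (Ψ.measurable_flightStartOf hG.continuous_norm_sepVec hGm i n)
    fun _ hz => Ψ.flightStartOf_of_not_mem hz i n

/-- The configuration at the flight start of the partner is a measurable function of the datum.
[folklore] -/
theorem measurable_flow_partnerFlightStartOf (hG : G.IsHardSphereRegular ε)
    (hGm : Measurable fun p : X × X => G.sepVec p.1 p.2) (i : Fin N) (n : ℕ) :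
    Measurable fun z => Ψ.flow (Ψ.partnerFlightStartOf i n z) z :=
  Ψ.measurable_flow_at (regular_continuous_translate hG) (Ψ.measurable_partnerFlightStartOf hG hGm i n)
    fun _ hz => Ψ.partnerFlightStartOf_of_not_mem hz i n

/-! ### Phases, normal, outgoing and incoming data -/

/-- **The contact phases are a measurable function of the datum.** [folklore] -/
theorem measurable_nthContactPhases (hG : G.IsHardSphereRegular ε)
    (hGm : Measurable fun p : X × X => G.sepVec p.1 p.2) (i : Fin N) (n : ℕ) :
    Measurable (Ψ.nthContactPhases i n) := by
  have hw := Ψ.measurable_nthContactConfig hG hGm i n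
  have hJ := Ψ.measurable_nthPartnerOf hG hGm i n
  exact ((measurable_pi_apply i).comp hw).snd.fst.prodMk (measurable_apply_random hw hJ).snd.fst

/-- **The contact normal is a measurable function of the datum.** [folklore] -/
theorem measurable_nthContactNormal (hG : G.IsHardSphereRegular ε)
    (hGm : Measurable fun p : X × X => G.sepVec p.1 p.2) (i : Fin N) (n : ℕ) :
    Measurable (Ψ.nthContactNormal i n) := by
  have hw := Ψ.measurable_nthContactConfig hG hGm i n
  have hJ := Ψ.measurable_nthPartnerOf hG hGm i n
  have hpair : Measurable fun z => ((Ψ.nthContactConfig i n z i).1.1,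
      (Ψ.nthContactConfig i n z (Ψ.nthPartnerOf i n z)).1.1) :=
    ((measurable_pi_apply i).comp hw).fst.fst.prodMk (measurable_apply_random hw hJ).fst.fst
  have h := (measurable_normalisedSep hGm).comp hpair
  show Measurable fun z => loadedNormal G (Ψ.nthContactConfig i n z) i (Ψ.nthPartnerOf i n z)
  simp only [loadedNormal]
  simpa only [Function.comp_def] using h

/-- **The outgoing data are a measurable function of the datum.** [folklore] -/
theorem measurable_nthPostData (hG : G.IsHardSphereRegular ε)
    (hGm : Measurable fun p : X × X => G.sepVec p.1 p.2) (i : Fin N) (n : ℕ) :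
    Measurable (Ψ.nthPostData i n) := by
  have hw := Ψ.measurable_nthContactConfig hG hGm i n
  have hJ := Ψ.measurable_nthPartnerOf hG hGm i n
  have hi : Measurable fun z => Ψ.nthContactConfig i n z i := (measurable_pi_apply i).comp hw
  have hj : Measurable fun z => Ψ.nthContactConfig i n z (Ψ.nthPartnerOf i n z) :=
    measurable_apply_random hw hJ
  exact (hi.fst.snd.prodMk hj.fst.snd).prodMk (hi.snd.snd.prodMk hj.snd.snd)

/-- **The incoming data are a measurable function of the datum** (the impact map applied to
measurable arguments). [folklore] -/
theorem measurable_nthPreData (hG : G.IsHardSphereRegular ε)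
    (hGm : Measurable fun p : X × X => G.sepVec p.1 p.2) (i : Fin N) (n : ℕ) :
    Measurable (Ψ.nthPreData i n) := by
  have h := (measurable_loadedImpact ε ξ ι).comp
    ((((Ψ.measurable_nthContactPhases hG hGm i n).fst.prodMk
      ((Ψ.measurable_nthContactPhases hG hGm i n).snd.prodMk
        (Ψ.measurable_nthContactNormal hG hGm i n))).prodMk (Ψ.measurable_nthPostData hG hGm i n)))
  simpa only [Function.comp_def, ← nthPreData_eq] using h

/-- The incoming relative direction `ĝ` is a measurable function of the datum. [folklore] -/
theorem measurable_nthInDir (hG : G.IsHardSphereRegular ε)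
    (hGm : Measurable fun p : X × X => G.sepVec p.1 p.2) (i : Fin N) (n : ℕ) :
    Measurable (Ψ.nthInDir i n) := by
  have h : Measurable fun z => (Ψ.nthPreData i n z).1.1 - (Ψ.nthPreData i n z).1.2 :=
    (Ψ.measurable_nthPreData hG hGm i n).fst.fst.sub (Ψ.measurable_nthPreData hG hGm i n).fst.snd
  exact h.norm.inv.smul h

/-- The `n`-th record is a field-by-field measurable function of the datum: its tuple of fields is
measurable. [folklore] -/
theorem measurable_nthRecordOf_fields (hG : G.IsHardSphereRegular ε)
    (hGm : Measurable fun p : X × X => G.sepVec p.1 p.2) (i : Fin N) (n : ℕ) :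
    Measurable fun z => ((Ψ.nthRecordOf i n z).time, ((Ψ.nthRecordOf i n z).fst,
      (Ψ.nthRecordOf i n z).snd), ((Ψ.nthRecordOf i n z).fstPos, (Ψ.nthRecordOf i n z).sndPos),
      (Ψ.nthRecordOf i n z).normal, (Ψ.nthRecordOf i n z).phases, (Ψ.nthRecordOf i n z).preData,
      (Ψ.nthRecordOf i n z).postData) := by
  have hw := Ψ.measurable_nthContactConfig hG hGm i n
  have hJ := Ψ.measurable_nthPartnerOf hG hGm i n
  exact (Ψ.measurable_nthCollisionTimeOf hG.continuous_norm_sepVec hGm i n).prodMk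
    ((measurable_const.prodMk hJ).prodMk
      ((((measurable_pi_apply i).comp hw).fst.fst.prodMk (measurable_apply_random hw hJ).fst.fst).prodMk
        ((Ψ.measurable_nthContactNormal hG hGm i n).prodMk
          ((Ψ.measurable_nthContactPhases hG hGm i n).prodMk
            ((Ψ.measurable_nthPreData hG hGm i n).prodMk (Ψ.measurable_nthPostData hG hGm i n))))))

/-- **The `n`-th record is a measurable function of the datum.** [folklore] -/
theorem measurable_nthRecordOf (hG : G.IsHardSphereRegular ε)
    (hGm : Measurable fun p : X × X => G.sepVec p.1 p.2) (i : Fin N) (n : ℕ) :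
    Measurable (Ψ.nthRecordOf i n) :=
  LoadedCollisionRecord.measurable_iff_tuple.2 (Ψ.measurable_nthRecordOf_fields hG hGm i n)

/-! ### The coarse past and the others' data -/

/-- **The coarse past is a measurable function of the initial datum** (measurable cell maps).
[folklore] -/
theorem measurable_coarsePastOf (hG : G.IsHardSphereRegular ε)
    (hGm : Measurable fun p : X × X => G.sepVec p.1 p.2) {C Cv : Type*} [MeasurableSpace C]
    [MeasurableSpace Cv] {q : X → C} {qv : E³ → Cv} (hq : Measurable q) (hqv : Measurable qv)
    (i : Fin N) (n : ℕ) : Measurable (Ψ.coarsePastOf q qv i n) :=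
  ((measurable_loadedCoarseConfig hq hqv).comp (Ψ.measurable_flow_flightStartOf hG hGm i n)).prodMk
    ((measurable_loadedCoarseConfig hq hqv).comp (Ψ.measurable_flow_partnerFlightStartOf hG hGm i n))

/-- **The others' initial data are a measurable function of the initial datum.** [folklore] -/
theorem measurable_othersInitialOf (hG : G.IsHardSphereRegular ε)
    (hGm : Measurable fun p : X × X => G.sepVec p.1 p.2) (i : Fin N) (n : ℕ) :
    Measurable (Ψ.othersInitialOf i n) := by
  have hJ := Ψ.measurable_nthPartnerOf hG hGm i n
  refine measurable_pi_lambda _ fun k => ?_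
  have hs : MeasurableSet {z : LoadedConfig N X | k = i ∨ k = Ψ.nthPartnerOf i n z} := by
    have he : {z : LoadedConfig N X | k = i ∨ k = Ψ.nthPartnerOf i n z} =
        {_z | k = i} ∪ Ψ.nthPartnerOf i n ⁻¹' {k} := by
      ext z
      simp only [mem_setOf_eq, mem_union, mem_preimage, mem_singleton_iff]
      constructor
      · rintro (h | h)
        · exact Or.inl h
        · exact Or.inr h.symm
      · rintro (h | h)
        · exact Or.inl h
        · exact Or.inr h.symm
    rw [he]
    exact (MeasurableSet.const _).union (hJ (measurableSet_singleton k))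
  simp only [othersInitialOf_apply]
  exact Measurable.ite hs measurable_const (measurable_inr.comp (measurable_pi_apply k))

/-- **The coarse past generates a sub-σ-algebra of the ambient σ-algebra** — unconditionally for a
loaded flow in a regular geometry with measurable separation map and measurable cell maps: the
hypothesis of `coarsePastSigma_le` discharged, so that `MeasureTheory.condExp` given the coarse
past is not junk. [folklore] -/
theorem coarsePastSigma_le_of_isHardSphereRegular (hG : G.IsHardSphereRegular ε)
    (hGm : Measurable fun p : X × X => G.sepVec p.1 p.2) {C Cv : Type*} [MeasurableSpace C]
    [MeasurableSpace Cv] {q : X → C} {qv : E³ → Cv} (hq : Measurable q) (hqv : Measurable qv)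
    (i : Fin N) (n : ℕ) :
    Ψ.coarsePastSigma q qv i n ≤ (inferInstance : MeasurableSpace (LoadedConfig N X)) :=
  Ψ.coarsePastSigma_le (Ψ.measurable_coarsePastOf hG hGm hq hqv i n)

/-- **The finer σ-algebra (coarse past and others' data) is a sub-σ-algebra of the ambient one**,
unconditionally under the same hypotheses. [folklore] -/
theorem coarsePastOthersSigma_le_of_isHardSphereRegular (hG : G.IsHardSphereRegular ε)
    (hGm : Measurable fun p : X × X => G.sepVec p.1 p.2) {C Cv : Type*} [MeasurableSpace C]
    [MeasurableSpace Cv] {q : X → C} {qv : E³ → Cv} (hq : Measurable q) (hqv : Measurable qv)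
    (i : Fin N) (n : ℕ) :
    Ψ.coarsePastOthersSigma q qv i n ≤ (inferInstance : MeasurableSpace (LoadedConfig N X)) :=
  Ψ.coarsePastOthersSigma_le (Ψ.measurable_coarsePastOf hG hGm hq hqv i n)
    (Ψ.measurable_othersInitialOf hG hGm i n)

/-! ### The exceptional contact classes are measurable events -/

/-- **Re-contacts form a measurable event.** [folklore] -/
theorem measurableSet_isRecontact (hG : G.IsHardSphereRegular ε)
    (hGm : Measurable fun p : X × X => G.sepVec p.1 p.2) (i : Fin N) (n : ℕ) :
    MeasurableSet {z | Ψ.IsRecontact i n z} :=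
  (MeasurableSet.const _).inter
    (measurableSet_eq_fun (Ψ.measurable_nthPartnerOf hG hGm i n)
      (Ψ.measurable_nthPartnerOf hG hGm i (n - 1)))

/-- **Short flights form a measurable event.** [folklore] -/
theorem measurableSet_isShortFlight (hG : G.IsHardSphereRegular ε)
    (hGm : Measurable fun p : X × X => G.sepVec p.1 p.2) (i : Fin N) (n : ℕ) (s : ℝ) :
    MeasurableSet {z | Ψ.IsShortFlight i n z s} := by
  have hτ := Ψ.measurable_nthCollisionTimeOf hG.continuous_norm_sepVec hGm i n
  exact (measurableSet_lt (hτ.sub (Ψ.measurable_flightStartOf hG.continuous_norm_sepVec hGm i n))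
    measurable_const).union
      (measurableSet_lt (hτ.sub (Ψ.measurable_partnerFlightStartOf hG hGm i n)) measurable_const)

/-- **Near-grazing contacts form a measurable event.** [folklore] -/
theorem measurableSet_isGrazing (hG : G.IsHardSphereRegular ε)
    (hGm : Measurable fun p : X × X => G.sepVec p.1 p.2) (i : Fin N) (n : ℕ) (δ : ℝ) :
    MeasurableSet {z | Ψ.IsGrazing i n z δ} := by
  have h : Measurable fun z => |⟪Ψ.nthInDir i n z, Ψ.nthContactNormal i n z⟫_ℝ| :=
    continuous_abs.measurable.comp
      ((Ψ.measurable_nthInDir hG hGm i n).inner (Ψ.measurable_nthContactNormal hG hGm i n))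
  exact measurableSet_lt h measurable_const

/-- **Near-polar contacts form a measurable event.** [folklore] -/
theorem measurableSet_isPolar (hG : G.IsHardSphereRegular ε)
    (hGm : Measurable fun p : X × X => G.sepVec p.1 p.2) (i : Fin N) (n : ℕ) (δ : ℝ) :
    MeasurableSet {z | Ψ.IsPolar i n z δ} := by
  have h1 : Measurable fun z => |⟪(Ψ.nthContactPhases i n z).1, Ψ.nthContactNormal i n z⟫_ℝ| :=
    continuous_abs.measurable.comp
      ((Ψ.measurable_nthContactPhases hG hGm i n).fst.inner
        (Ψ.measurable_nthContactNormal hG hGm i n))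
  have h2 : Measurable fun z => |⟪(Ψ.nthContactPhases i n z).2, Ψ.nthContactNormal i n z⟫_ℝ| :=
    continuous_abs.measurable.comp
      ((Ψ.measurable_nthContactPhases hG hGm i n).snd.inner
        (Ψ.measurable_nthContactNormal hG hGm i n))
  simp only [IsPolar, setOf_or]
  exact (measurableSet_lt measurable_const h1).union (measurableSet_lt measurable_const h2)

end Borel

/-! ### On the flat torus `𝕋³` -/

section Torus

variable {ε ξ ι : ℝ} {N : ℕ} (Ψ : LoadedSphereFlow (Torus.geometry (Fin 3)) ε ξ ι N)

/-- On `𝕋³` with spheres of diameter `ε < 1/2` the coarse past of a loaded flow generates a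
sub-σ-algebra of the Borel σ-algebra, for measurable cell maps (all hypotheses of
`coarsePastSigma_le_of_isHardSphereRegular` hold: `Torus.isHardSphereRegular_geometry`,
`Torus.measurable_geometry_sepVec`). [folklore] -/
theorem coarsePastSigma_le_torus (hε : ε < 2⁻¹) {C Cv : Type*} [MeasurableSpace C]
    [MeasurableSpace Cv] {q : UnitAddTorus (Fin 3) → C} {qv : E³ → Cv} (hq : Measurable q)
    (hqv : Measurable qv) (i : Fin N) (n : ℕ) :
    Ψ.coarsePastSigma q qv i n ≤
      (inferInstance : MeasurableSpace (LoadedConfig N (UnitAddTorus (Fin 3)))) :=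
  Ψ.coarsePastSigma_le_of_isHardSphereRegular (Torus.isHardSphereRegular_geometry hε)
    Torus.measurable_geometry_sepVec hq hqv i n

/-- On `𝕋³` with `ε < 1/2` the finer σ-algebra (coarse past and others' data) is a sub-σ-algebra of
the Borel σ-algebra. [folklore] -/
theorem coarsePastOthersSigma_le_torus (hε : ε < 2⁻¹) {C Cv : Type*} [MeasurableSpace C]
    [MeasurableSpace Cv] {q : UnitAddTorus (Fin 3) → C} {qv : E³ → Cv} (hq : Measurable q)
    (hqv : Measurable qv) (i : Fin N) (n : ℕ) :
    Ψ.coarsePastOthersSigma q qv i n ≤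
      (inferInstance : MeasurableSpace (LoadedConfig N (UnitAddTorus (Fin 3)))) :=
  Ψ.coarsePastOthersSigma_le_of_isHardSphereRegular (Torus.isHardSphereRegular_geometry hε)
    Torus.measurable_geometry_sepVec hq hqv i n

/-- On `𝕋³` with `ε < 1/2` the contact phases of a loaded flow are a measurable function of the
initial datum. [folklore] -/
theorem measurable_nthContactPhases_torus (hε : ε < 2⁻¹) (i : Fin N) (n : ℕ) :
    Measurable (Ψ.nthContactPhases i n) :=
  Ψ.measurable_nthContactPhases (Torus.isHardSphereRegular_geometry hε)
    Torus.measurable_geometry_sepVec i n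

/-- On `𝕋³` with `ε < 1/2` the event "the `n`-th contact of `i` exists and is not exceptional"
(`HasNthContact ∧ ¬IsRecontact ∧ ¬IsShortFlight s ∧ ¬IsGrazing δ ∧ ¬IsPolar δ'`) is measurable.
[folklore] -/
theorem measurableSet_hasNthContact_not_exceptional_torus (hε : ε < 2⁻¹) (i : Fin N) (n : ℕ)
    (s δ δ' : ℝ) :
    MeasurableSet {z | Ψ.HasNthContact i n z ∧ ¬ Ψ.IsRecontact i n z ∧ ¬ Ψ.IsShortFlight i n z s ∧
      ¬ Ψ.IsGrazing i n z δ ∧ ¬ Ψ.IsPolar i n z δ'} := by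
  have hG := Torus.isHardSphereRegular_geometry (d := Fin 3) hε
  have hGm := Torus.measurable_geometry_sepVec (d := Fin 3)
  exact (Ψ.measurableSet_hasNthContact hG hGm i n).inter
    ((Ψ.measurableSet_isRecontact hG hGm i n).compl.inter
      ((Ψ.measurableSet_isShortFlight hG hGm i n s).compl.inter
        ((Ψ.measurableSet_isGrazing hG hGm i n δ).compl.inter
          (Ψ.measurableSet_isPolar hG hGm i n δ').compl)))

end Torus

end LoadedSphereFlow

end

end Literature.Analysis.FluidPDE
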